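import Mathlib

/-!
# Route MarginalStabilityChain · BurgersLayerLowRe — Gaussian-class integrability and a priori decay

Helper file (supports stmt-AnomalousDissipation-3010, `BurgersLayerLowRe`): functions dominated by
`(A + B|y| + Dy²)e^{−cy²}` are integrable; `|y|e^{−y²/4} ≤ 1`; continuous functions vanishing at `±∞`
are bounded; and the integrating-factor estimate behind the a priori Gaussian decay of `ω'`:
if `‖ω'' + yω'‖ ≤ Ke^{−y²/4}` then `‖ω'(y)‖ ≤ (‖ω'(0)‖ + K|y|)e^{−y²/4}` (from
`(e^{y²/2}ω')' = e^{y²/2}(ω'' + yω')`). All folklore.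
-/

noncomputable section

open MeasureTheory Set Filter Topology
open scoped Real RealInnerProductSpace Interval

namespace Summit.AnomalousDissipation.AnomalousDissipation.Theorems.MarginalStabilityChainBurgersLayerLowRe

-- the summit and its single sub-problem share the name `AnomalousDissipation` (tree layout D-0017)
set_option linter.dupNamespace false

/-! ### Gaussian-class integrability and the a priori decay of `ω'` -/

section Decay

variable {E : Type*} [NormedAddCommGroup E]

/-- A measurable function dominated by `(A + B|y| + D y²) e^{−c y²}` (`c > 0`) is integrable on the
line. [folklore] -/
theorem integrable_of_norm_le_gauss {f : ℝ → E} (hf : AEStronglyMeasurable f volume) {c A B D : ℝ}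
    (hc : 0 < c) (h : ∀ y, ‖f y‖ ≤ (A + B * |y| + D * y ^ 2) * Real.exp (-c * y ^ 2)) : Integrable f := by
  have h0 : Integrable (fun y : ℝ => Real.exp (-c * y ^ 2)) := integrable_exp_neg_mul_sq hc
  have h1 : Integrable (fun y : ℝ => |y| * Real.exp (-c * y ^ 2)) := by
    have h := (integrable_mul_exp_neg_mul_sq hc).norm
    refine h.congr (Eventually.of_forall fun y => ?_)
    simp only [norm_mul, Real.norm_eq_abs, abs_of_pos (Real.exp_pos _)]
  have h2 : Integrable (fun y : ℝ => y ^ 2 * Real.exp (-c * y ^ 2)) := by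
    have h := integrable_rpow_mul_exp_neg_mul_sq hc (s := 2) (by norm_num)
    refine h.congr (Eventually.of_forall fun y => ?_)
    simp only [Real.rpow_two]
  have hg : Integrable (fun y : ℝ => (|A| + |B| * |y| + |D| * y ^ 2) * Real.exp (-c * y ^ 2)) := by
    have : (fun y : ℝ => (|A| + |B| * |y| + |D| * y ^ 2) * Real.exp (-c * y ^ 2)) =
        fun y => |A| * Real.exp (-c * y ^ 2) + |B| * (|y| * Real.exp (-c * y ^ 2)) + |D| * (y ^ 2 * Real.exp (-c * y ^ 2)) := by
      funext y; ring
    rw [this]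
    exact ((h0.const_mul _).add (h1.const_mul _)).add (h2.const_mul _)
  refine hg.mono' hf (Eventually.of_forall fun y => (h y).trans ?_)
  have he : 0 < Real.exp (-c * y ^ 2) := Real.exp_pos _
  apply mul_le_mul_of_nonneg_right _ he.le
  have hy : 0 ≤ |y| := abs_nonneg y
  have hy2 : 0 ≤ y ^ 2 := sq_nonneg y
  nlinarith [le_abs_self A, le_abs_self B, le_abs_self D, mul_le_mul_of_nonneg_right (le_abs_self B) hy,
    mul_le_mul_of_nonneg_right (le_abs_self D) hy2]

/-- `e^{−y²/4}` in Mathlib's Gaussian normal form. [folklore] -/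
theorem exp_quarter (y : ℝ) : Real.exp (-(y ^ 2) / 4) = Real.exp (-(1 / 4) * y ^ 2) := by
  congr 1; ring

/-- `e^{−y²/2}` in Mathlib's Gaussian normal form. [folklore] -/
theorem exp_half (y : ℝ) : Real.exp (-(y ^ 2) / 2) = Real.exp (-(1 / 2) * y ^ 2) := by
  congr 1; ring

/-- `|y| e^{−y²/4} ≤ 1` (since `e^{y²/4} ≥ 1 + y²/4 ≥ |y|`). [folklore] -/
theorem abs_mul_exp_quarter_le_one (y : ℝ) : |y| * Real.exp (-(y ^ 2) / 4) ≤ 1 := by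
  have h1 : |y| ≤ 1 + y ^ 2 / 4 := by
    have : 0 ≤ (|y| - 2) ^ 2 := sq_nonneg _
    have hsq : |y| ^ 2 = y ^ 2 := sq_abs y
    nlinarith
  have h2 : y ^ 2 / 4 + 1 ≤ Real.exp (y ^ 2 / 4) := Real.add_one_le_exp _
  have h3 : Real.exp (-(y ^ 2) / 4) * Real.exp (y ^ 2 / 4) = 1 := by
    rw [← Real.exp_add]; simp only [Real.exp_eq_one_iff]; ring
  have h4 : 0 < Real.exp (-(y ^ 2) / 4) := Real.exp_pos _
  nlinarith [mul_le_mul_of_nonneg_right (h1.trans (by linarith : 1 + y ^ 2 / 4 ≤ Real.exp (y ^ 2 / 4))) h4.le]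

/-- A continuous function on the line tending to `0` at `±∞` is bounded. [folklore] -/
theorem exists_norm_le_of_tendsto {f : ℝ → ℂ} (hf : Continuous f) (htop : Tendsto f atTop (𝓝 0))
    (hbot : Tendsto f atBot (𝓝 0)) : ∃ B, ∀ y, ‖f y‖ ≤ B := by
  have h : Tendsto f (cocompact ℝ) (𝓝 0) := by rw [cocompact_eq_atBot_atTop]; exact hbot.sup htop
  obtain ⟨K, hK, hKf⟩ := mem_cocompact.mp (h (Metric.closedBall_mem_nhds (0 : ℂ) zero_lt_one))
  obtain ⟨C, hC⟩ := hK.exists_bound_of_continuousOn hf.continuousOn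
  refine ⟨max C 1, fun y => ?_⟩
  by_cases hy : y ∈ K
  · exact (hC y hy).trans (le_max_left _ _)
  · have hy' : f y ∈ Metric.closedBall (0 : ℂ) 1 := hKf hy
    rw [Metric.mem_closedBall, dist_zero_right] at hy'
    exact hy'.trans (le_max_right _ _)

/-- Points of `Ι 0 y` have modulus `≤ |y|`. [folklore] -/
theorem abs_le_of_mem_uIoc {s y : ℝ} (hs : s ∈ Ι (0 : ℝ) y) : |s| ≤ |y| := by
  rw [Set.mem_uIoc] at hs
  rcases hs with ⟨h1, h2⟩ | ⟨h1, h2⟩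
  · rw [abs_of_pos h1]; exact h2.trans (le_abs_self y)
  · rw [abs_of_nonpos h2, abs_of_neg (h1.trans_le h2)]; exact neg_le_neg h1.le

/-- **A priori Gaussian decay of `ω'`** (integrating factor `e^{y²/2}`): if
`‖ω'' + y ω'‖ ≤ K e^{−y²/4}` on the line, then `‖ω'(y)‖ ≤ (‖ω'(0)‖ + K|y|) e^{−y²/4}`. [folklore] -/
theorem norm_deriv_le_gauss {ω' ω'' : ℝ → ℂ} (hω' : ∀ y, HasDerivAt ω' (ω'' y) y) (hc : Continuous ω'')
    {K : ℝ} (hR : ∀ y, ‖ω'' y + y * ω' y‖ ≤ K * Real.exp (-(y ^ 2) / 4)) (y : ℝ) :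
    ‖ω' y‖ ≤ (‖ω' 0‖ + K * |y|) * Real.exp (-(y ^ 2) / 4) := by
  have hK : 0 ≤ K := by
    have h := hR 0
    simp only [ne_eq, OfNat.ofNat_ne_zero, not_false_eq_true, zero_pow, neg_zero, zero_div, Real.exp_zero,
      mul_one] at h
    exact (norm_nonneg _).trans h
  have hcont' : Continuous ω' := continuous_iff_continuousAt.2 fun s => (hω' s).continuousAt
  -- the integrating factor
  set Φ : ℝ → ℂ := fun s => ((Real.exp (s ^ 2 / 2) : ℝ) : ℂ) * ω' s with hΦ
  set Φ' : ℝ → ℂ := fun s => ((Real.exp (s ^ 2 / 2) : ℝ) : ℂ) * (ω'' s + s * ω' s) with hΦ'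
  have hw : ∀ s, HasDerivAt (fun u : ℝ => ((Real.exp (u ^ 2 / 2) : ℝ) : ℂ)) (((Real.exp (s ^ 2 / 2) * s : ℝ) : ℂ)) s := by
    intro s
    have h1 : HasDerivAt (fun u : ℝ => Real.exp (u ^ 2 / 2)) (Real.exp (s ^ 2 / 2) * s) s := by
      have h := ((hasDerivAt_pow 2 s).div_const 2).exp
      refine h.congr_deriv ?_
      ring
    exact h1.ofReal_comp
  have hΦd : ∀ s, HasDerivAt Φ (Φ' s) s := fun s => by
    have h := (hw s).mul (hω' s)
    refine h.congr_deriv ?_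
    simp only [hΦ']; push_cast; ring
  have hΦ'c : Continuous Φ' := by
    simp only [hΦ']
    exact (Complex.continuous_ofReal.comp (by fun_prop)).mul (hc.add ((Complex.continuous_ofReal).mul hcont'))
  -- FTC on `[0, y]`
  have hftc : ∫ s in (0 : ℝ)..y, Φ' s = Φ y - Φ 0 :=
    intervalIntegral.integral_eq_sub_of_hasDerivAt (fun s _ => hΦd s) (hΦ'c.intervalIntegrable _ _)
  have hΦ0 : Φ 0 = ω' 0 := by simp [hΦ]
  -- bound of the integrand on `Ι 0 y`
  have hbd : ∀ s ∈ Ι (0 : ℝ) y, ‖Φ' s‖ ≤ K * Real.exp (y ^ 2 / 4) := by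
    intro s hs
    have hsy : |s| ≤ |y| := abs_le_of_mem_uIoc hs
    have hs2 : s ^ 2 ≤ y ^ 2 := by nlinarith [abs_nonneg s, sq_abs s, sq_abs y]
    simp only [hΦ', norm_mul, Complex.norm_real, Real.norm_of_nonneg (Real.exp_pos _).le]
    calc Real.exp (s ^ 2 / 2) * ‖ω'' s + s * ω' s‖
        ≤ Real.exp (s ^ 2 / 2) * (K * Real.exp (-(s ^ 2) / 4)) := by gcongr; exact hR s
      _ = K * Real.exp (s ^ 2 / 4) := by
          rw [mul_comm, mul_assoc, ← Real.exp_add]; congr 2; ring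
      _ ≤ K * Real.exp (y ^ 2 / 4) := by gcongr
  have hint : ‖∫ s in (0 : ℝ)..y, Φ' s‖ ≤ K * Real.exp (y ^ 2 / 4) * |y| := by
    have h := intervalIntegral.norm_integral_le_of_norm_le_const hbd
    rwa [sub_zero] at h
  -- assemble
  have hΦy : ‖Φ y‖ ≤ ‖ω' 0‖ + K * Real.exp (y ^ 2 / 4) * |y| := by
    have : Φ y = Φ 0 + ∫ s in (0 : ℝ)..y, Φ' s := by rw [hftc]; ring
    rw [this, hΦ0]
    exact (norm_add_le _ _).trans (add_le_add le_rfl hint)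
  have hnorm : ‖Φ y‖ = Real.exp (y ^ 2 / 2) * ‖ω' y‖ := by
    simp only [hΦ, norm_mul, Complex.norm_real, Real.norm_of_nonneg (Real.exp_pos _).le]
  have e1 : Real.exp (-(y ^ 2) / 4) * Real.exp (y ^ 2 / 2) = Real.exp (y ^ 2 / 4) := by
    rw [← Real.exp_add]; congr 1; ring
  have e2 : Real.exp (-(y ^ 2) / 4) * Real.exp (y ^ 2 / 4) = 1 := by
    rw [← Real.exp_add]; simp only [Real.exp_eq_one_iff]; ring
  have hpos : 0 < Real.exp (y ^ 2 / 2) := Real.exp_pos _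
  have hq : 0 < Real.exp (-(y ^ 2) / 4) := Real.exp_pos _
  have hq1 : Real.exp (-(y ^ 2) / 4) ≤ 1 := by
    rw [Real.exp_le_one_iff]; have := sq_nonneg y; linarith
  -- `‖ω' y‖ = e^{-y²/2} ‖Φ y‖ ≤ e^{-y²/2}‖ω' 0‖ + K|y| e^{-y²/4}`
  rw [hnorm] at hΦy
  have key : Real.exp (y ^ 2 / 4) * ‖ω' y‖ ≤ ‖ω' 0‖ * Real.exp (-(y ^ 2) / 4) + K * |y| := by
    have h := mul_le_mul_of_nonneg_left hΦy hq.le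
    calc Real.exp (y ^ 2 / 4) * ‖ω' y‖ = Real.exp (-(y ^ 2) / 4) * (Real.exp (y ^ 2 / 2) * ‖ω' y‖) := by
          rw [← mul_assoc, e1]
      _ ≤ Real.exp (-(y ^ 2) / 4) * (‖ω' 0‖ + K * Real.exp (y ^ 2 / 4) * |y|) := h
      _ = ‖ω' 0‖ * Real.exp (-(y ^ 2) / 4) + K * |y| := by linear_combination (K * |y|) * e2
  have key2 : Real.exp (y ^ 2 / 4) * ‖ω' y‖ ≤ ‖ω' 0‖ + K * |y| := by
    refine key.trans ?_
    nlinarith [norm_nonneg (ω' 0)]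
  calc ‖ω' y‖ = Real.exp (-(y ^ 2) / 4) * (Real.exp (y ^ 2 / 4) * ‖ω' y‖) := by rw [← mul_assoc, e2, one_mul]
    _ ≤ Real.exp (-(y ^ 2) / 4) * (‖ω' 0‖ + K * |y|) := by gcongr
    _ = (‖ω' 0‖ + K * |y|) * Real.exp (-(y ^ 2) / 4) := by ring

end Decay

end Summit.AnomalousDissipation.AnomalousDissipation.Theorems.MarginalStabilityChainBurgersLayerLowRe
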